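import Summits.Ventures.CertifiedArithmetic.Expansions.EstimateErrorBoundWeak
import Mathlib.Tactic.Linarith
import Mathlib.Tactic.Positivity
import Mathlib.Tactic.Ring
import Mathlib.Tactic.NormNum

/-!
# The absolute error `|estimate − Σ| ≤ (6/7)·u·2^s` on class `W`

NEW WORK in the sense of this development (companion of `EstimateErrorBoundWeak.lean`, whose
structural lemma `IsWeakExpansion.shape_below_top` and rounding lemma
`abs_fl_estimate_add_sub_le_of_odd_top` it reuses).  For every weakly nonoverlapping (`W`)
expansion of floats with components `< 2^s` in magnitude (`p ≥ 1`, ANY round-to-nearest, any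
length, zeros allowed):
* `abs_estimate_sub_sum_le_of_isWeakExpansion_two_zpow` — **`|estimate l − Σ l| ≤ (6/7)·u·2^s`**
  (`u = 2^−p`), improving on the subclass `W` the constant `1` that `EstimateErrorBound` proves for
  all nonoverlapping expansions (`IsWeakExpansion.isExpansion`: every `W` list is nonoverlapping).

PROOF.  Strong induction on the length, peeling the top `a = M·2^v` (`M` odd, `|a| ≤ 2^s − 2^v`,
last rounding `≤ (u/2)·2^s`).  In the first shape of `IsWeakExpansion.shape_below_top` the
prefix lies below `2^(v−1)` and costs `≤ (6/7)·u·2^(v−1)`, total `≤ (1/2 + 3/14)·u·2^s = 5/7`; in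
the second shape `estimate l₁` costs `≤ (6/7)·u·2^(v−2)`, the rounding of `estimate l₁ + x₀`
(magnitude `≤ 2^v`) costs `≤ (u/2)·2^v`, total `≤ (1/2 + 1/4 + 3/28)·u·2^s = 6/7` — the budget
map `x ↦ 1/2 + max (x/4, 1/4 + x/8)` has the fixed point `6/7`, so `6/7` is the least constant
this skeleton proves (the coupled invariant of `EstimateErrorBoundWeak` trades it for
`3 − (5/2)·|Σ|/2^s`, which is what the relative bound needs).

EVIDENCE (exhaustive enumeration, engines drafts `estimate_ulp_search/`, class `W`, components
`p`-bit integers below `2^E`, lengths `≤ N`): the largest `|estimate − Σ|/(u·2^s)` found is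
`0.7175, 0.7341, 0.7421` under ties-to-even (`p = 4, 5, 6`) but `0.8564` at `p = 3`, `N = 8`
with adversarial ties (`⟨−1, −12, −32, −64, −256, −512, −2048, −4096⟩`, every tie resolved toward
zero, estimate `−6144`, `Σ = −7021`), consistent with `6/7 = 0.857…` being the supremum over all
round-to-nearest tie rules (no lower-bound family is formalised here); under ties-to-even the
true constant appears to be smaller.

Reference for the routine and the class: J. R. Shewchuk, Discrete Comput. Geom. 18 (1997)
305–363, §2.7 (`APPROXIMATE`) and `predicates.c` [Shewchuk1997].
-/

namespace Summit.Ventures.CertifiedArithmetic.Expansions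

open Literature.ComputerArithmetic.JeannerodRump2018
open Literature.ComputerArithmetic.BoldoJeannerodMelquiondMuller2023 hiding twoSum twoSum_fst
  isFloat_twoSum
open Literature.ComputerArithmetic.JoldesMullerPopescu2017 (isFloat_two_zpow abs_fl_le_of_abs_le)
open Literature.ComputerArithmetic.RumpOgitaOishi2008 (eq_zero_of_isFloat_of_abs_lt)
open Literature.ComputerArithmetic.Shewchuk1997

variable {p : ℕ} {emin : ℤ} {fl : ℚ → ℚ}

/-! ## The absolute error `|estimate − Σ| ≤ (6/7)·u·2^s` -/

set_option maxHeartbeats 800000 in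
/-- **`|estimate − Σ| ≤ (6/7)·u·2^s` ON WEAKLY NONOVERLAPPING EXPANSIONS** with components `< 2^s`
in magnitude (`p ≥ 1`, any round-to-nearest `fl` into `F(p, emin)`, any length, zeros allowed).
The two shapes of `IsWeakExpansion.shape_below_top` cost `1/2 + (6/7)/4 = 5/7` and
`1/2 + (1/2 + (6/7)/4)/2 = 6/7` (units `u·2^s`); `6/7` is approached by the chains
`⟨…, −2^(k−3), −2^(k−2), −2^k, −2^(k+1)⟩` under a tie rule rounding ties toward zero (evidence
in the module docstring; the lower bound is not formalised). -/
theorem abs_estimate_sub_sum_le_of_isWeakExpansion_two_zpow (hp : 1 ≤ p)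
    (hfl : IsRoundNearest p emin fl) :
    ∀ {l : List ℚ}, (∀ x ∈ l, IsFloat p emin x) → IsWeakExpansion l →
      ∀ {s : ℤ}, (∀ x ∈ l, |x| < (2 : ℚ) ^ s) →
        |estimate fl l - l.sum| ≤ 6 / 7 * unitRoundoff p * (2 : ℚ) ^ s := by
  have hu0 : 0 ≤ unitRoundoff p := by unfold unitRoundoff; positivity
  suffices H : ∀ n : ℕ, ∀ {l : List ℚ}, l.length ≤ n → (∀ x ∈ l, IsFloat p emin x) →
      IsWeakExpansion l → ∀ {s : ℤ}, (∀ x ∈ l, |x| < (2 : ℚ) ^ s) →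
        |estimate fl l - l.sum| ≤ 6 / 7 * unitRoundoff p * (2 : ℚ) ^ s by
    intro l hF hW s hs; exact H l.length le_rfl hF hW hs
  have hnil : ∀ s : ℤ, |estimate fl [] - ([] : List ℚ).sum| ≤
      6 / 7 * unitRoundoff p * (2 : ℚ) ^ s := by
    intro s
    rw [show estimate fl [] = 0 from rfl, List.sum_nil, sub_zero, abs_zero]
    exact mul_nonneg (mul_nonneg (by norm_num) hu0) (zpow_nonneg (by norm_num) _)
  intro n
  induction n with
  | zero =>
    intro l hl _ _ s _
    rw [List.eq_nil_of_length_eq_zero (Nat.le_zero.mp hl)]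
    exact hnil s
  | succ n ih =>
    intro l hl hF hW s hs
    rcases l.eq_nil_or_concat with rfl | ⟨l, a, rfl⟩
    · exact hnil s
    simp only [List.concat_eq_append] at hl hF hW hs ⊢
    have hln : l.length ≤ n := by simp at hl; omega
    have hFl : ∀ x ∈ l, IsFloat p emin x := fun x hx => hF x (by simp [hx])
    have hFa : IsFloat p emin a := hF a (by simp)
    have hWl : IsWeakExpansion l := hW.sublist (List.sublist_append_left l [a])
    have hEl : IsExpansion 1 l := hWl.isExpansion
    have hsl : ∀ x ∈ l, |x| < (2 : ℚ) ^ s := fun x hx => hs x (by simp [hx])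
    have hsa : |a| < (2 : ℚ) ^ s := hs a (by simp)
    have h2s : (0 : ℚ) < (2 : ℚ) ^ s := zpow_pos (by norm_num) _
    have hus : 0 ≤ unitRoundoff p * (2 : ℚ) ^ s := mul_nonneg hu0 h2s.le
    rw [List.sum_append, List.sum_singleton]
    by_cases hl0 : l = []
    · subst hl0
      rw [show estimate fl ([] ++ [a]) = a from rfl, List.sum_nil, zero_add, sub_self, abs_zero]
      linarith
    rw [estimate_append_singleton fl hl0]
    have hQF : IsFloat p emin (estimate fl l) := isFloat_estimate hfl hFl
    by_cases ha0 : a = 0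
    · rw [ha0, add_zero, add_zero, fl_eq_self hfl hQF]; exact ih hln hFl hWl hsl
    obtain ⟨M, v, hMo, -, -, hav⟩ := exists_odd_mul_two_zpow hFa ha0
    obtain ⟨hv, hshape⟩ := IsWeakExpansion.shape_below_top hW hMo hav
    obtain ⟨hva, haabs, hδ⟩ :=
      abs_fl_estimate_add_sub_le_of_odd_top hp hfl hFl hEl hFa hMo hav hv hsa
    have h2v : (0 : ℚ) < (2 : ℚ) ^ v := zpow_pos (by norm_num) _
    have h2vs : 2 * (2 : ℚ) ^ v ≤ (2 : ℚ) ^ s := by linarith [hva.trans haabs]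
    have h2v1 : (0 : ℚ) < (2 : ℚ) ^ (v - 1) := zpow_pos (by norm_num) _
    have h2v2 : (0 : ℚ) < (2 : ℚ) ^ (v - 2) := zpow_pos (by norm_num) _
    have hX : 0 ≤ unitRoundoff p * (2 : ℚ) ^ (v - 2) := mul_nonneg hu0 h2v2.le
    have e1 : (2 : ℚ) ^ v = 2 * (2 : ℚ) ^ (v - 1) := by
      rw [mul_comm, ← zpow_add_one₀ (by norm_num : (2 : ℚ) ≠ 0), sub_add_cancel]
    have e2 : (2 : ℚ) ^ (v - 1) = 2 * (2 : ℚ) ^ (v - 2) := by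
      rw [mul_comm, ← zpow_add_one₀ (by norm_num : (2 : ℚ) ≠ 0)]; ring_nf
    have hmul := mul_le_mul_of_nonneg_left h2vs hu0
    -- it remains to bound the error of the prefix by `(5/7)·u·2^v ≤ (5/14)·u·2^s`
    suffices hE : |estimate fl l - l.sum| ≤ 5 / 7 * unitRoundoff p * (2 : ℚ) ^ v by
      calc |fl (estimate fl l + a) - (l.sum + a)|
          = |(fl (estimate fl l + a) - (estimate fl l + a)) + (estimate fl l - l.sum)| := by
            congr 1; ring
        _ ≤ |fl (estimate fl l + a) - (estimate fl l + a)| + |estimate fl l - l.sum| :=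
            abs_add_le _ _
        _ ≤ unitRoundoff p / 2 * (2 : ℚ) ^ s + 5 / 7 * unitRoundoff p * (2 : ℚ) ^ v :=
            add_le_add hδ hE
        _ ≤ 6 / 7 * unitRoundoff p * (2 : ℚ) ^ s := by linarith
    rcases hshape with hv1 | ⟨l₁, x₀, l₂, rfl, hx₀abs, hl₂, hl₁⟩
    · -- first shape: the prefix lies below `2^(v-1)` and costs `≤ (6/7)·u·2^(v-1) = (3/7)·u·2^v`
      have hIH := ih hln hFl hWl hv1
      rw [e1, e2] at *
      linarith
    -- second shape: `l = l₁ ++ [x₀] ++ zeros`, `|x₀| = 2^(v-1)`, `l₁` below `2^(v-2)`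
    have hF₁ : ∀ y ∈ l₁, IsFloat p emin y := fun y hy => hFl y (by simp [hy])
    have hFx₀ : IsFloat p emin x₀ := hFl x₀ (by simp)
    have hW₁ : IsWeakExpansion l₁ := hWl.sublist (List.sublist_append_left l₁ (x₀ :: l₂))
    have hE₁ : IsExpansion 1 l₁ := hW₁.isExpansion
    have hln₁ : l₁.length ≤ n := le_trans (by simp) hln
    have hS : (l₁ ++ x₀ :: l₂).sum = l₁.sum + x₀ := by
      rw [List.sum_append, List.sum_cons, List.sum_eq_zero hl₂, add_zero]
    have hQeq : estimate fl (l₁ ++ x₀ :: l₂) = estimate fl (l₁ ++ [x₀]) := by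
      rw [show l₁ ++ x₀ :: l₂ = (l₁ ++ [x₀]) ++ l₂ by simp]
      exact estimate_append_of_forall_eq_zero hfl (by simp)
        (fun y hy => by
          rcases List.mem_append.mp hy with h | h
          · exact hF₁ y h
          · rw [List.mem_singleton.mp h]; exact hFx₀) hl₂
    rw [hS, hQeq]
    by_cases hl₁0 : l₁ = []
    · subst hl₁0
      rw [show estimate fl ([] ++ [x₀]) = x₀ from rfl, List.sum_nil, zero_add, sub_self, abs_zero]
      exact mul_nonneg (mul_nonneg (by norm_num) hu0) h2v.le
    rw [estimate_append_singleton fl hl₁0]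
    -- `Q₁ = estimate l₁` costs `≤ (6/7)·u·2^(v-2)`; rounding `Q₁ + x₀` (`≤ 2^v`) costs `(u/2)·2^v`
    have hQ₁F : IsFloat p emin (estimate fl l₁) := isFloat_estimate hfl hF₁
    have hQ₁ : |estimate fl l₁| ≤ (2 : ℚ) ^ (v - 2) := abs_estimate_le_two_zpow hp hfl hF₁ hE₁ hl₁
    have hIH₁ := ih hln₁ hF₁ hW₁ hl₁
    have hTG : OnGrid emin (estimate fl l₁ + x₀) :=
      (OnGrid.of_isFloat hQ₁F).add (OnGrid.of_isFloat hFx₀)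
    have hTv : |estimate fl l₁ + x₀| ≤ (2 : ℚ) ^ v := by
      have := abs_add_le (estimate fl l₁) x₀
      rw [hx₀abs] at this
      linarith
    have hδ₂ := abs_fl_sub_le_half_u_two_zpow hp hfl hTG hTv
    calc |fl (estimate fl l₁ + x₀) - (l₁.sum + x₀)|
        = |(fl (estimate fl l₁ + x₀) - (estimate fl l₁ + x₀)) + (estimate fl l₁ - l₁.sum)| := by
          congr 1; ring
      _ ≤ |fl (estimate fl l₁ + x₀) - (estimate fl l₁ + x₀)| + |estimate fl l₁ - l₁.sum| :=
          abs_add_le _ _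
      _ ≤ unitRoundoff p / 2 * (2 : ℚ) ^ v + 6 / 7 * unitRoundoff p * (2 : ℚ) ^ (v - 2) :=
          add_le_add hδ₂ hIH₁
      _ ≤ 5 / 7 * unitRoundoff p * (2 : ℚ) ^ v := by
          rw [e1, e2] at *; linarith

end Summit.Ventures.CertifiedArithmetic.Expansions
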